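import Summits.QuantumAdvantage.QuantumAdvantage.Theorems.WbwObfuscatedGluedTreesKowCoinNormalisation
import Summits.QuantumAdvantage.QuantumAdvantage.Theorems.WbwObfuscatedGluedTreesKowSeedLaw

/-!
# `WbwObfuscatedGluedTrees` (stmt-QuantumAdvantage-2340) — line `knowledge-of-walk-split`, stub `stub_obfuscationMonotone` I: the reduction machine

Stub `stub_obfuscationMonotone` ("obfuscation is monotone") of the skeleton
`Cruxes/WbwObfuscatedGluedTrees/Lines/knowledge-of-walk-split.lean` (crux `WbwObfuscatedGluedTrees`, route
`WhiteBoxWalk`; lead prover-line-stmt-QuantumAdvantage-2340-0): clause (C) for the CLEAR key-indexed circuit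
family implies clause (C) for its honest obfuscations.  This file is the generic half of the proof — the
REDUCTION `ObfMono.redAlg K Ob A₁ qO Q` and its two properties; the sequel
`WbwObfuscatedGluedTreesKowObfuscationMonotone.lean` instantiates it on the genuine instances and proves the
stub.

* `ObfMono.redAlg`: on input `x = ⟨u, ⟨c, e⟩⟩` with coins `ρ`, recompute the obfuscator's input
  `inO = ⟨K u, c⟩` (`K` = a total `FP` extension of the schedule `1ⁿ ↦ 1^{κ n}`), GUESS the obfuscator's
  (non-computable) coin count `j = min ⟦ρ ↾ w⟧ (qO |inO|)` off the first `w = width qO |inO|` coins,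
  re-obfuscate `c' = Ob ⟨inO, (ρ ⇂ w) ↾ j⟩` (`Ob` = a total `FP` extension of the obfuscator's machine) and
  run `A₁` on `⟨u, ⟨c', e⟩⟩` with ALL remaining coins `ρ ⇂ (w + qO |inO|)`; budget `Q`.
* `ObfMono.isPPT_redAlg`: the run map is ONE brick expression (`ObfMono.redB`) around `K`, `Ob` and an `FP`
  extension of `A₁`'s machine, so the reduction is PPT (`FPExtension.isPolyTime_of_FP`).
* `ObfMono.pr_redAlg_ge` (the guessing inequality): for a prefix-stable `A₁`, any `j ≤ qO |inO|` and a budget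
  covering guess block + `qO |inO|` + `A₁`'s demand,
  `2^{-w} · avg_{r ∈ {0,1}^j} Pr[A₁(x'(r)) ∈ E] ≤ Pr[redAlg(x) ∈ E]` (restrict to the coin strings whose guess
  block is the word of `j`; product rule; condition on the obfuscator's coin block; prefix stability).
* `ObfMono.L0P/L1P/XP/QP/lossP`: the size polynomials (bounds on `|inO|`, `|⟨inO, r⟩|`, `|x'|`, the budget,
  the loss) with their values.
* `obfMono_machine`: registered helper stub (closed form of `ObfMono.isPPT_redAlg`).

No security property of the obfuscator is used anywhere; no hardness is asserted.
-/

set_option linter.dupNamespace false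

noncomputable section

namespace Summit.QuantumAdvantage.QuantumAdvantage.Theorems.WbwObfuscatedGluedTrees.KnowledgeOfWalk

open Literature.Computability.Cryptography Literature.Computability.Complexity
open _root_.Computability Brick Plumb

namespace ObfMono

/-! ### The reduction `A'`: re-obfuscate with guessed coins, then run the (normalised) adversary -/

/-- `O`'s input as recomputed by the reduction from its own input `x = ⟨u, ⟨c, e⟩⟩`: `⟨K u, c⟩`
(`K` = the schedule `1ⁿ ↦ 1^{κ n}` as a total `FP` function). [folklore] -/
def inO (K : List Bool → List Bool) (x : List Bool) : List Bool :=
  boolPair (K (fstF x)) (fstF (sndF x))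

/-- The manufactured input `⟨u, ⟨Ob ⟨inO, r⟩, e⟩⟩` (the circuit re-obfuscated with coins `r`) handed to the
adversary. [folklore] -/
def newInput (K Ob : List Bool → List Bool) (x r : List Bool) : List Bool :=
  boolPair (fstF x) (boolPair (Ob (boolPair (inO K x) r)) (sndF (sndF x)))

/-- The obfuscator's coins as GUESSED by the reduction out of its coin string `ρ`: the guess
`j = min ⟦ρ ↾ w⟧ (qO L₀)` of the (non-computable) coin count is read off the first
`w = width qO L₀` coins, the coins themselves are the next `j`. [cite: AroraBarakCC2009, §7.1] -/
def obfCoins (qO : Polynomial ℕ) (L₀ : ℕ) (ρ : List Bool) : List Bool :=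
  (ρ.drop (CoinNormalisation.width qO L₀)).take
    (min (bitsToNat (ρ.take (CoinNormalisation.width qO L₀))) (qO.eval L₀))

/-- The leftover coins `ρ ⇂ (w + qO L₀)` (all of them) handed to the adversary. [folklore] -/
def restCoins (qO : Polynomial ℕ) (L₀ : ℕ) (ρ : List Bool) : List Bool :=
  (ρ.drop (CoinNormalisation.width qO L₀)).drop (qO.eval L₀)

/-- **The reduction** against the clear instances: guess `O`'s coin count, re-obfuscate the clear circuit
with a prefix of its own coins, and run the adversary `A₁` on the manufactured instance with all remaining
coins; coin budget `Q`. [folklore] -/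
def redAlg (K Ob : List Bool → List Bool) (A₁ : RandAlg (List Bool) (List Bool))
    (qO Q : Polynomial ℕ) : RandAlg (List Bool) (List Bool) where
  run x ρ := A₁.run (newInput K Ob x (obfCoins qO (inO K x).length ρ)) (restCoins qO (inO K x).length ρ)
  coinLen L := Q.eval L

/-! ### The reduction is an `FP` string program around `K`, `Ob` and `A₁`'s machine -/

/-- Brick for `inO` on `z = ⟨x, ρ⟩`. [folklore] -/
def inOB (K : List Bool → List Bool) : List Bool → List Bool :=
  fanoutFn (K ∘ fstF ∘ fstF) (fstF ∘ sndF ∘ fstF)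

/-- Brick for the binary numeral of `qO |inO|` (its length is the guess width `w`). [folklore] -/
def wB (K : List Bool → List Bool) (qO : Polynomial ℕ) : List Bool → List Bool :=
  lenBinF ∘ polyFn qO ∘ inOB K

/-- Brick for `ρ ⇂ w`. [folklore] -/
def restB (K : List Bool → List Bool) (qO : Polynomial ℕ) : List Bool → List Bool :=
  dropFn ∘ fanoutFn (wB K qO) sndF

/-- Brick for the guessed coins `(ρ ⇂ w) ↾ min ⟦ρ ↾ w⟧ (qO |inO|)`. [folklore] -/
def coinsB (K : List Bool → List Bool) (qO : Polynomial ℕ) : List Bool → List Bool :=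
  takeFn ∘ fanoutFn
    (binToUnaryFn ∘ fanoutFn (polyFn qO ∘ inOB K) (takeFn ∘ fanoutFn (wB K qO) sndF)) (restB K qO)

/-- Brick for the manufactured input `x'`. [folklore] -/
def newInputB (K Ob : List Bool → List Bool) (qO : Polynomial ℕ) : List Bool → List Bool :=
  fanoutFn (fstF ∘ fstF) (fanoutFn (Ob ∘ fanoutFn (inOB K) (coinsB K qO)) (sndF ∘ sndF ∘ fstF))

/-- Brick for the whole reduction: `R₁ ⟨x', ρ ⇂ (w + qO |inO|)⟩`. [folklore] -/
def redB (K Ob R₁ : List Bool → List Bool) (qO : Polynomial ℕ) : List Bool → List Bool :=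
  R₁ ∘ fanoutFn (newInputB K Ob qO) (dropFn ∘ fanoutFn (polyFn qO ∘ inOB K) (restB K qO))

section values

variable (K Ob R₁ : List Bool → List Bool) (qO : Polynomial ℕ) (x ρ : List Bool)

/-- Value of `inOB`. [folklore] -/
theorem inOB_apply : inOB K (boolPair x ρ) = inO K x := by
  simp [inOB, inO]

/-- Value of `wB`. [folklore] -/
theorem wB_apply : wB K qO (boolPair x ρ) = encodeNat (qO.eval (inO K x).length) := by
  simp [wB, inOB_apply]

/-- Value of `restB`. [folklore] -/
theorem restB_apply : restB K qO (boolPair x ρ) = ρ.drop (CoinNormalisation.width qO (inO K x).length) := by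
  simp [restB, wB_apply, CoinNormalisation.width]

/-- Value of `coinsB`. [folklore] -/
theorem coinsB_apply : coinsB K qO (boolPair x ρ) = obfCoins qO (inO K x).length ρ := by
  simp [coinsB, restB_apply, wB_apply, inOB_apply, obfCoins, CoinNormalisation.width]

/-- Value of `newInputB`. [folklore] -/
theorem newInputB_apply :
    newInputB K Ob qO (boolPair x ρ) = newInput K Ob x (obfCoins qO (inO K x).length ρ) := by
  simp [newInputB, coinsB_apply, inOB_apply, newInput]

/-- Value of `redB`: it computes the run map of `redAlg`. [folklore] -/
theorem redB_apply {A₁ : RandAlg (List Bool) (List Bool)} (Q : Polynomial ℕ)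
    (hR : ∀ x r : List Bool, R₁ (boolPair x r) = A₁.run x r) :
    redB K Ob R₁ qO (boolPair x ρ) = (redAlg K Ob A₁ qO Q).run x ρ := by
  simp [redB, newInputB_apply, restB_apply, inOB_apply, hR, redAlg, restCoins]

end values

/-- `redB ∈ FP` for `K, Ob, R₁ ∈ FP`. [cite: AroraBarakCC2009, Thm. 1.9 and §1.4.1] -/
theorem redB_mem_FP {K Ob R₁ : List Bool → List Bool} (hK : K ∈ FP) (hOb : Ob ∈ FP) (hR : R₁ ∈ FP)
    (qO : Polynomial ℕ) : redB K Ob R₁ qO ∈ FP := by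
  have hinO : inOB K ∈ FP :=
    fanoutFn_mem_FP (comp_mem_FP hK (comp_mem_FP fstF_mem_FP fstF_mem_FP))
      (comp_mem_FP fstF_mem_FP (comp_mem_FP sndF_mem_FP fstF_mem_FP))
  have hw : wB K qO ∈ FP := comp_mem_FP lenBinF_mem_FP (comp_mem_FP (polyFn_mem_FP qO) hinO)
  have hrest : restB K qO ∈ FP := comp_mem_FP dropFn_mem_FP (fanoutFn_mem_FP hw sndF_mem_FP)
  have hcoins : coinsB K qO ∈ FP :=
    comp_mem_FP takeFn_mem_FP (fanoutFn_mem_FP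
      (comp_mem_FP binToUnaryFn_mem_FP (fanoutFn_mem_FP (comp_mem_FP (polyFn_mem_FP qO) hinO)
        (comp_mem_FP takeFn_mem_FP (fanoutFn_mem_FP hw sndF_mem_FP)))) hrest)
  have hnew : newInputB K Ob qO ∈ FP :=
    fanoutFn_mem_FP (comp_mem_FP fstF_mem_FP fstF_mem_FP)
      (fanoutFn_mem_FP (comp_mem_FP hOb (fanoutFn_mem_FP hinO hcoins))
        (comp_mem_FP sndF_mem_FP (comp_mem_FP sndF_mem_FP fstF_mem_FP)))
  exact comp_mem_FP hR (fanoutFn_mem_FP hnew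
    (comp_mem_FP dropFn_mem_FP (fanoutFn_mem_FP (comp_mem_FP (polyFn_mem_FP qO) hinO) hrest)))

/-- **The reduction is PPT** whenever `K, Ob ∈ FP` and `A₁` is PPT (its coin budget `Q` is a polynomial by
construction). [folklore] -/
theorem isPPT_redAlg {K Ob : List Bool → List Bool} {A₁ : RandAlg (List Bool) (List Bool)}
    (hK : K ∈ FP) (hOb : Ob ∈ FP) (hA₁ : IsPPT A₁ id) (qO Q : Polynomial ℕ) :
    IsPPT (redAlg K Ob A₁ qO Q) id := by
  obtain ⟨R₁, hR₁, hrun⟩ := FPExtension.exists_FP_run hA₁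
  exact FPExtension.isPolyTime_of_FP (redB_mem_FP hK hOb hR₁ qO)
    (fun x r => redB_apply K Ob R₁ qO x r Q hrun) ⟨Q, fun _ => le_rfl⟩

/-! ### The guessing inequality for the reduction -/

/-- **Per-input inequality.**  If `A₁` is prefix-stable (any uniform budget `N ≥ A₁.coinLen |x'|` gives the
same output law), `j ≤ qO |inO|`, and the budget `Q |x|` covers the guess block, `qO |inO|` coins for the
obfuscator and `A₁`'s demand on every manufactured input, then
`2^{-w} · avg_{r ∈ {0,1}^j} Pr[A₁(x'(r)) ∈ E] ≤ Pr[redAlg(x) ∈ E]`: restrict to the coin strings whose guess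
block is the word of `j`. [cite: AroraBarakCC2009, §7.1] -/
theorem pr_redAlg_ge (K Ob : List Bool → List Bool) (A₁ : RandAlg (List Bool) (List Bool))
    (qO Q : Polynomial ℕ)
    (hstab : ∀ (x : List Bool) (E : Set (List Bool)) (N : ℕ), A₁.coinLen x.length ≤ N →
      uniformProb N {ρ | A₁.run x ρ ∈ E} = A₁.pr id x E)
    (x : List Bool) (E : Set (List Bool)) {j : ℕ} (hj : j ≤ qO.eval (inO K x).length)
    (hQ : ∀ r : List Bool, r.length ≤ qO.eval (inO K x).length →
      CoinNormalisation.width qO (inO K x).length + qO.eval (inO K x).length +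
          A₁.coinLen (newInput K Ob x r).length ≤ Q.eval x.length) :
    1 / 2 ^ CoinNormalisation.width qO (inO K x).length *
        uniformAvg j (fun r => A₁.pr id (newInput K Ob x r) E) ≤
      (redAlg K Ob A₁ qO Q).pr id x E := by
  set L₀ := (inO K x).length with hL₀
  set w := CoinNormalisation.width qO L₀ with hw
  have hwq : w + qO.eval L₀ ≤ Q.eval x.length := by
    have := hQ [] (by simp)
    omega
  obtain ⟨N, hN⟩ := Nat.exists_eq_add_of_le hwq
  set T : Set (List Bool) := {t | A₁.run (newInput K Ob x (t.take j)) (t.drop (qO.eval L₀)) ∈ E} with hT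
  have hsub : {ρ : List Bool | ρ.take w ∈ {y : List Bool | y = CoinNormalisation.word w j} ∧ ρ.drop w ∈ T} ⊆
      {ρ | (redAlg K Ob A₁ qO Q).run x ρ ∈ E} := by
    rintro ρ ⟨h1, h2⟩
    simp only [Set.mem_setOf_eq] at h1 h2 ⊢
    have hjw : bitsToNat (ρ.take w) = j := by
      rw [h1]
      exact CoinNormalisation.bitsToNat_word_of_lt (CoinNormalisation.lt_two_pow_width qO hj)
    have hco : obfCoins qO L₀ ρ = (ρ.drop w).take j := by
      simp only [obfCoins, ← hw, hjw, min_eq_left hj]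
    show A₁.run (newInput K Ob x (obfCoins qO L₀ ρ)) (restCoins qO L₀ ρ) ∈ E
    rw [hco]
    exact h2
  have hpr : (redAlg K Ob A₁ qO Q).pr id x E =
      uniformProb (w + (qO.eval L₀ + N)) {ρ | (redAlg K Ob A₁ qO Q).run x ρ ∈ E} := by
    rw [RandAlg.pr_eq_uniformProb, ← add_assoc, ← hN]
    rfl
  have hprod := CoinNormalisation.uniformProb_take_drop w (qO.eval L₀ + N)
    {y : List Bool | y = CoinNormalisation.word w j} T
  rw [CoinNormalisation.uniformProb_singleton (CoinNormalisation.length_word w j)] at hprod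
  have hsplit : uniformProb (qO.eval L₀ + N) T = uniformAvg j (fun r => A₁.pr id (newInput K Ob x r) E) := by
    rw [SeedLaw.uniformProb_split,
      ← SeedLaw.uniformAvg_take_of_le hj (fun r => A₁.pr id (newInput K Ob x r) E)]
    refine uniformAvg_congr fun v hv => ?_
    have hjv : j ≤ v.length := hv ▸ hj
    have hset : {z : List Bool | v ++ z ∈ T} = {z | A₁.run (newInput K Ob x (v.take j)) z ∈ E} := by
      ext z
      simp only [Set.mem_setOf_eq, hT]
      rw [List.take_append_of_le_length hjv, List.drop_left' hv]
    rw [hset]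
    refine hstab _ _ _ ?_
    have := hQ (v.take j) (by simp only [List.length_take]; omega)
    omega
  calc 1 / 2 ^ w * uniformAvg j (fun r => A₁.pr id (newInput K Ob x r) E)
      = uniformProb (w + (qO.eval L₀ + N))
          {ρ : List Bool | ρ.take w ∈ {y : List Bool | y = CoinNormalisation.word w j} ∧ ρ.drop w ∈ T} := by
        rw [hprod, hsplit]
    _ ≤ uniformProb (w + (qO.eval L₀ + N)) {ρ | (redAlg K Ob A₁ qO Q).run x ρ ∈ E} :=
        CoinNormalisation.uniformProb_mono hsub
    _ = (redAlg K Ob A₁ qO Q).pr id x E := hpr.symm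

/-! ### Size polynomials of the reduction -/

/-- Bound `2 pκ(L) + 2 + L` on `|inO|` for a genuine input of length `L`. [folklore] -/
def L0P (pκ : Polynomial ℕ) : Polynomial ℕ := 2 * pκ + 2 + Polynomial.X

/-- Bound on `|⟨inO, r⟩|` for `|r| ≤ qO |inO|`. [folklore] -/
def L1P (pκ qO : Polynomial ℕ) : Polynomial ℕ := 2 * L0P pκ + 2 + qO.comp (L0P pκ)

/-- Bound on the manufactured input `|x'|` (`sOb` = output-length polynomial of `Ob`). [folklore] -/
def XP (pκ qO sOb : Polynomial ℕ) : Polynomial ℕ :=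
  3 * Polynomial.X + 4 + 2 * sOb.comp (L1P pκ qO)

/-- The reduction's coin budget: guess block `≤ qO |inO| + 1`, `qO |inO|` coins for the obfuscator, and the
adversary's demand `≤ 2 pA |x'| + 1`. [folklore] -/
def QP (pκ qO sOb pA : Polynomial ℕ) : Polynomial ℕ :=
  2 * qO.comp (L0P pκ) + 2 * pA.comp (XP pκ qO sOb) + 2

/-- The loss polynomial at level `n`: the product of the two guessing losses `2 pA(XP(Lmax n)) + 2` (coin
count of `A`) and `2 qO(L0P(Lmax n)) + 2` (coin count of `O`), `Lmax n = 2n + 2 + q n`. [folklore] -/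
def lossP (pκ qO sOb pA q : Polynomial ℕ) : Polynomial ℕ :=
  (2 * pA.comp ((XP pκ qO sOb).comp (2 * Polynomial.X + 2 + q)) + 2) *
    (2 * qO.comp ((L0P pκ).comp (2 * Polynomial.X + 2 + q)) + 2)

section evals

variable (pκ qO sOb pA q : Polynomial ℕ) (L : ℕ)

/-- Value of `L0P`. [folklore] -/
theorem eval_L0P : (L0P pκ).eval L = 2 * pκ.eval L + 2 + L := by
  simp [L0P]

/-- Value of `L1P`. [folklore] -/
theorem eval_L1P : (L1P pκ qO).eval L = 2 * (L0P pκ).eval L + 2 + qO.eval ((L0P pκ).eval L) := by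
  simp [L1P, Polynomial.eval_comp]

/-- Value of `XP`. [folklore] -/
theorem eval_XP : (XP pκ qO sOb).eval L = 3 * L + 4 + 2 * sOb.eval ((L1P pκ qO).eval L) := by
  simp [XP, Polynomial.eval_comp]

/-- Value of `QP`. [folklore] -/
theorem eval_QP : (QP pκ qO sOb pA).eval L =
    2 * qO.eval ((L0P pκ).eval L) + 2 * pA.eval ((XP pκ qO sOb).eval L) + 2 := by
  simp [QP, Polynomial.eval_comp]

/-- Value of `lossP`. [folklore] -/
theorem eval_lossP : (lossP pκ qO sOb pA q).eval L =
    (2 * pA.eval ((XP pκ qO sOb).eval (2 * L + 2 + q.eval L)) + 2) *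
      (2 * qO.eval ((L0P pκ).eval (2 * L + 2 + q.eval L)) + 2) := by
  simp [lossP, Polynomial.eval_comp]

end evals

end ObfMono

/-- Registered helper stub of crux stmt-QuantumAdvantage-2340 (closed form of `ObfMono.isPPT_redAlg`, file I of
stub `stub_obfuscationMonotone`): the re-obfuscation reduction is PPT. [folklore] -/
theorem obfMono_machine :
    ∀ (K Ob : List Bool → List Bool) (A₁ : RandAlg (List Bool) (List Bool)) (qO Q : Polynomial ℕ), K ∈ FP → Ob ∈ FP → IsPPT A₁ id → IsPPT (ObfMono.redAlg K Ob A₁ qO Q) id :=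
  fun _ _ _ qO Q hK hOb hA₁ => ObfMono.isPPT_redAlg hK hOb hA₁ qO Q

end Summit.QuantumAdvantage.QuantumAdvantage.Theorems.WbwObfuscatedGluedTrees.KnowledgeOfWalk

end
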